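import Summits.CriticalPhenomena.PercolationContinuityZ3.Theorems.PercNearOneGluingNoHeavyLowerTailHullPortTANSetMarkerDominance
import HarnessLib

/-!
# `NoHeavyLowerTail` (stmt-CriticalPhenomena-4575) — the set-observer marker dominance lemma at the PRINCIPAL up-set:
# a law-level 'superadditivity under gluing' inequality (side `S1` of the (GΨ₃) hexagon)

Support file (`--supports stmt-CriticalPhenomena-4575`, closed), coupling seat `prim-cplus-coupling` (gen 15).  No
definitions, no named facts, no sorries; standard axioms.

prim-hp-7's `HullPort.setMarkerDominance_hcov` (the set-observer marker dominance lemma, Kozma–Nitzan Question 9 at `|A| = 3`)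
holds for every monotone cluster function `F`.  At the principal up-set `F = 1{y ∈ ·}` it is a LAW-LEVEL inequality between
connection probabilities of `x, y, z` and an observer set `N` (memo A5-COUPLING-gen15.md §5, row S1):
`μ(Ny,¬Nx,¬Nz) · μ(x↔y, x↮z) · μ(x↮y, x↮z) ≤ μ(y↮x, y↮z) · [μ(x↮y, x↮z) · μ(Nx,¬Nz, x↔y) − μ(x↔y, x↮z) · μ(Nx,¬Nz, x↮y)]`,
i.e. (dividing)  `P(Nx, N↮z | x↔y, x↮z) − P(Nx, N↮z | x↮y, x↮z) ≥ P(Ny, N↮x, N↮z | y↮x, y↮z) = φ₂`: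
gluing `y` to `x` raises the chance that the observer set sees `x` but not `z` by at least the chance it sees `y` alone.  With
`P(Nx, N↮z | x↮{y,z}) ≥ φ₁` this gives `P(Nx, N↮z | x↔y, x↮z) ≥ φ₁ + φ₂` (the `(yz)`-side of the certificate hexagon of (GΨ₃);
at `N = {o}` it explains and sharpens the by-product `φE1 + φE2 ≤ 1` of `…Q7PsiMaxRobust.lean`).

* `Q7Psi.setMDL_principal` — the product (denominator-free) form above.
[cite: KozmaNitzan2024, Question 9 (p. 36), §5.1 (pp. 31–32)] [cite: VandenbergHaggstromKahn2005, Thms. 1.3–1.5 (pp. 6–7)]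
-/

namespace Summit.CriticalPhenomena.PercolationContinuityZ3.Theorems

open MeasureTheory Set Literature.Probability.LatticeModels Literature.Probability.Percolation
open scoped Classical

noncomputable section

namespace Q7Psi

universe u

variable {V : Type u} [Fintype V]

/-- **Set-observer marker dominance at the principal up-set `1{y ∈ ·}` (law-level form).**  For `x ≠ y`, any `z`, any
observer set `N`, with `g = μ(x↔y, x↮z)`:
`μ(Ny,¬Nx,¬Nz) · (μ(x↮z)·g − g·g) ≤ μ(y↮x, y↮z) · (μ(x↮z)·μ(Nx,¬Nz, x↔y) − μ(Nx,¬Nz)·g)`;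
since `μ(x↮z) − g = μ(x↮y, x↮z)` and `{Nx,¬Nz} ⊆ {x↮z}` this reads
`P(Nx, N↮z | x↔y, x↮z) − P(Nx, N↮z | x↮y, x↮z) ≥ P(Ny, N↮x, N↮z | y↮x, y↮z)`.
(`HullPort.setMarkerDominance_hcov` at `F = 1{y ∈ ·}`.) [cite: KozmaNitzan2024, Question 9 (p. 36), §5.1 (pp. 31–32)] -/
theorem setMDL_principal (w : Sym2 V → unitInterval) (x y z : V) (N : Set V) (hxy : x ≠ y) :
    (prodBernoulli w).real ({ω : BondConfig V | ∃ n ∈ N, (openGraph ω).Reachable y n} ∩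
            ({ω | ∀ n ∈ N, ¬ (openGraph ω).Reachable x n} ∩ {ω | ∀ n ∈ N, ¬ (openGraph ω).Reachable z n})) *
        ((prodBernoulli w).real {ω : BondConfig V | ¬ (openGraph ω).Reachable x z} *
            (prodBernoulli w).real (openConn x y ∩ {ω | ¬ (openGraph ω).Reachable x z}) -
          (prodBernoulli w).real (openConn x y ∩ {ω | ¬ (openGraph ω).Reachable x z}) *
            (prodBernoulli w).real (openConn x y ∩ {ω | ¬ (openGraph ω).Reachable x z})) ≤
      (prodBernoulli w).real ({ω : BondConfig V | ¬ (openGraph ω).Reachable y x} ∩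
          {ω | ¬ (openGraph ω).Reachable y z}) *
        ((prodBernoulli w).real {ω : BondConfig V | ¬ (openGraph ω).Reachable x z} *
            (prodBernoulli w).real (({ω : BondConfig V | ∃ n ∈ N, (openGraph ω).Reachable x n} ∩
              {ω | ∀ n ∈ N, ¬ (openGraph ω).Reachable z n}) ∩ openConn x y) -
          (prodBernoulli w).real ({ω : BondConfig V | ∃ n ∈ N, (openGraph ω).Reachable x n} ∩
              {ω | ∀ n ∈ N, ¬ (openGraph ω).Reachable z n}) *
            (prodBernoulli w).real (openConn x y ∩ {ω | ¬ (openGraph ω).Reachable x z})) := by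
  classical
  set μ := prodBernoulli w with hμ
  have hmeas : ∀ T : Set (BondConfig V), MeasurableSet T := fun _ => MeasurableSet.of_discrete
  set F : Set V → ℝ := fun S => if y ∈ S then 1 else 0 with hFdef
  have hF : ∀ S T : Set V, S ⊆ T → F S ≤ F T := by
    intro S T hST
    by_cases hS : y ∈ S
    · simp only [hFdef, if_pos hS, if_pos (hST hS), le_refl]
    · simp only [hFdef, if_neg hS]
      split_ifs <;> norm_num
  have key := HullPort.setMarkerDominance_hcov w x y z N hxy F hF
  -- `F (C_x ω) = 1{ω ∈ {x ↔ y}}`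
  have hFind : (fun ω : BondConfig V => F (openCluster ω x)) = (openConn x y).indicator fun _ => (1 : ℝ) := by
    funext ω
    by_cases h : ω ∈ openConn x y
    · have h' : y ∈ openCluster ω x := h
      rw [indicator_of_mem h]
      simp only [hFdef, if_pos h']
    · have h' : y ∉ openCluster ω x := h
      rw [indicator_of_notMem h]
      simp only [hFdef, if_neg h']
  have hint : ∀ A : Set (BondConfig V), ∫ ω in A, F (openCluster ω x) ∂μ = μ.real (A ∩ openConn x y) := by
    intro A
    rw [hFind, setIntegral_indicator (hmeas _), setIntegral_const, smul_eq_mul, mul_one]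
  rw [hint, hint, hint] at key
  have h1 : (openConn x y ∩ {ω : BondConfig V | ¬ (openGraph ω).Reachable x z}) ∩ openConn x y =
      openConn x y ∩ {ω : BondConfig V | ¬ (openGraph ω).Reachable x z} := by
    rw [inter_comm, ← inter_assoc, inter_self]
  -- `{Nx, ¬Nz} ∩ {x↔y} ⊆ {x ↮ z}`, so `∫_{x↮z} 1{x↔y}` on that set is unrestricted
  have h2 : {ω : BondConfig V | ¬ (openGraph ω).Reachable x z} ∩ openConn x y =
      openConn x y ∩ {ω : BondConfig V | ¬ (openGraph ω).Reachable x z} := inter_comm _ _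
  rw [h1, h2] at key
  linarith [key]

end Q7Psi

end

end Summit.CriticalPhenomena.PercolationContinuityZ3.Theorems
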